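import Mathlib.Analysis.InnerProductSpace.GramSchmidtOrtho
import Mathlib.Analysis.InnerProductSpace.PiL2
import Mathlib.LinearAlgebra.Matrix.ToLin
import HarnessLib

/-!
# Route `VirialFluxGap` (YangMills): the RESOLVENT EULER FIELD — an ORTHONORMAL kernel family from linearly independent kernel vectors

Toward the deciding crux `VirialFluxGap.PeriodicSoftness` (item stmt-QuantumFields-24141), generic-region Euler field (memo v2, input (iii)).
✓`FrameHessian.generic_divergence_upper` takes `m` ORTHONORMAL vectors `k_a` (for the dot product on `ι → ℝ`) in the kernel of the raw frame
Hessian at the zero; ✓`hess_mulVec_eq_zero_of_valley_curve` ∕ ✓`tendsto_inv_smul_stdCoord_log` produce kernel vectors that are merely linearly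
independent.  This file is the Gram–Schmidt letter closing that gap:

* ★ `exists_orthonormal_kernel_family` — from `m` linearly independent vectors `w_a : ι → ℝ` with `B·w_a = 0` there are `m` vectors `k_a` with
  `k_a · k_b = δ_{ab}` and `B·k_a = 0` (Gram–Schmidt in `EuclideanSpace ℝ ι`; the span of kernel vectors lies in the kernel).

HONEST FRAMING: linear-algebra letter; ⟨24141⟩ stays OPEN; no stub / crux / rung / summit is closed; the Yang–Mills mass gap is NOT proved; no summit
is proved by a line.  THEOREMS ONLY (0 `def`, 0 `sorry`), standard axioms.  Explicit-unit seat `ym-line-fcl-p3` g40 (cell ym-idea-1, free hands),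
`--supports stmt-QuantumFields-24141`.  References: [folklore].
-/

set_option autoImplicit false

open Matrix WithLp InnerProductSpace
open scoped BigOperators InnerProductSpace

namespace Summit.QuantumFields.YangMills.Theorems.VirialFluxGap.ResolventField

variable {ι : Type*} [Fintype ι]

/-- ★ **Orthonormal kernel family from linearly independent kernel vectors.**  If `w_a : ι → ℝ` (`a : Fin m`) are linearly independent with
`B·w_a = 0`, there are `k_a` with `k_a · k_b = δ_{ab}` and `B·k_a = 0`. [folklore] -/
theorem exists_orthonormal_kernel_family {B : Matrix ι ι ℝ} {m : ℕ} (w : Fin m → ι → ℝ) (hli : LinearIndependent ℝ w)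
    (hker : ∀ a, B *ᵥ w a = 0) :
    ∃ k : Fin m → ι → ℝ, (∀ a b, k a ⬝ᵥ k b = if a = b then 1 else 0) ∧ ∀ a, B *ᵥ k a = 0 := by
  classical
  -- move to `EuclideanSpace ℝ ι`
  let e : (ι → ℝ) ≃ₗ[ℝ] EuclideanSpace ℝ ι := (WithLp.linearEquiv 2 ℝ (ι → ℝ)).symm
  let f : Fin m → EuclideanSpace ℝ ι := fun a => e (w a)
  have hf : LinearIndependent ℝ f := hli.map' e.toLinearMap (LinearEquiv.ker _)
  -- the kernel of `B` as a submodule of the Euclidean space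
  let T : EuclideanSpace ℝ ι →ₗ[ℝ] (ι → ℝ) := (Matrix.mulVecLin B).comp e.symm.toLinearMap
  have hTf : ∀ a, T (f a) = 0 := by
    intro a
    show B *ᵥ (e.symm (e (w a))) = 0
    rw [LinearEquiv.symm_apply_apply]; exact hker a
  have hspan : Submodule.span ℝ (Set.range f) ≤ LinearMap.ker T := by
    rw [Submodule.span_le]
    rintro _ ⟨a, rfl⟩
    exact hTf a
  -- Gram–Schmidt
  let g : Fin m → EuclideanSpace ℝ ι := gramSchmidtNormed ℝ f
  have hg : Orthonormal ℝ g := gramSchmidtNormed_orthonormal hf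
  have hgker : ∀ a, T (g a) = 0 := by
    intro a
    have hmem : gramSchmidt ℝ f a ∈ Submodule.span ℝ (Set.range f) := by
      have h := gramSchmidt_mem_span ℝ f (le_refl a)
      exact Submodule.span_mono (Set.image_subset_range _ _) h
    have hmem' : g a ∈ Submodule.span ℝ (Set.range f) := by
      show gramSchmidtNormed ℝ f a ∈ _
      unfold gramSchmidtNormed
      exact Submodule.smul_mem _ _ hmem
    exact hspan hmem'
  refine ⟨fun a => ofLp (g a), fun a b => ?_, fun a => ?_⟩
  · have h := (orthonormal_iff_ite.1 hg) a b
    rw [EuclideanSpace.inner_eq_star_dotProduct, star_trivial, dotProduct_comm] at h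
    exact h
  · have h := hgker a
    exact h

end Summit.QuantumFields.YangMills.Theorems.VirialFluxGap.ResolventField
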